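import Summits.CriticalPhenomena.PercolationContinuityZ3.Theses.PercLowPointHalfSpace
import Summits.CriticalPhenomena.PercolationContinuityZ3.Theorems.PercNearOneGluingNoHeavyLowerTailCSHTheoremOne
import Summits.CriticalPhenomena.PercolationContinuityZ3.Theorems.LowPointBookkeeping.Negative.LogicalStatus
import HarnessLib

/-!
# `PercLowPointHalfSpace.LowPointBookkeeping` (stmt-CriticalPhenomena-14713) — SETTLED after continuity

Item `stmt-CriticalPhenomena-14713` of route `CriticalPhenomena/PercLowPointHalfSpace` (crux): the low-point bookkeeping implication of route PercLowPointHalfSpace.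

The tree's `LowPointBookkeeping.Negative.not_not_lowPointBookkeeping_of_continuity` (`S → ¬¬K`: `¬K ↔ A ∧ B ∧ C ∧ ¬S`) at p205010, then double negation.

builds on p205010 (kernel theorem, internal audit signed; external expert review pending) — USED (`CSH.percolationContinuityZ3_holds`).  RSW3 lane, lead gen 28 (prover-prim-rsw3-lead-g28-0):
'after continuity — the ledger harvest'.
References: G. Kozma, N. Nitzan (2024), Thm. 6 / Conj. 3 [KozmaNitzan2024]; G. Grimmett, *Percolation* (1999), §8 [GrimmettPercolation1999].
-/

noncomputable section

namespace Summit.CriticalPhenomena.PercolationContinuityZ3.Theorems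

namespace PercLowPointHalfSpaceLowPointBookkeeping

open MeasureTheory Literature.Probability.Percolation Literature.Probability.LatticeModels

/-- **`PercLowPointHalfSpace.LowPointBookkeeping` (stmt-CriticalPhenomena-14713), settled.**  double negation of `LowPointBookkeeping.Negative.not_not_lowPointBookkeeping_of_continuity` at p205010.
[cite: KozmaNitzan2024, Thm. 6 with Conj. 3 (p. 15)] -/
theorem lowPointBookkeeping_proof : Summit.CriticalPhenomena.PercolationContinuityZ3.Theses.PercLowPointHalfSpace.LowPointBookkeeping := by
  exact Classical.not_not.mp (LowPointBookkeeping.Negative.not_not_lowPointBookkeeping_of_continuity CSH.percolationContinuityZ3_holds)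

end PercLowPointHalfSpaceLowPointBookkeeping

end Summit.CriticalPhenomena.PercolationContinuityZ3.Theorems

end
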